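import Mathlib
import HarnessLib
import HarnessLib.Audit
import Summits.AtomisticToContinuum.Statement

/-!
Route: TwoTimePressure

CLOSED (retired) 2026-08-15T13:47:28Z by operator:999:1257524 — reason: not-a-thesis: assembly does not conclude the sub-problem Statement — note: D-0027 §2.1 audit (human 2026-08-15: routes that do not decide the summit are removed): the assembly concludes `Literature.MathematicalPhysics.KineticTheory.HydrodynamicLimit`, not the sub-problem statement; a NEW conforming route may be opened from the same idea (generated `closes : … → _root_.Hydr. The file is kept as the record of this route; refuted decls are indexed as negative knowledge (`ledger negatives`).

# Route TwoTimePressure — HydrodynamicLimit as the Euler germ of the two-time pressure — mean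
identification + N-uniform sub-Gaussian tilt window; engine = analyticity and exact reversal
symmetry at the invariant Gibbs law

X = MeanEulerLimit ∧ TiltSubGaussian ("it suffices to show"), realising card
two-time-pressure-symmetry. The conjunct is a
statement about the GERM at μ = 0 of one convex function, the upper two-time pressure of the
conserved fields under the INITIAL
local Gibbs law, Λ̄_t(μ) = limsup_N (N+1)⁻¹ log E_LG exp((N+1)⟨μ, F_t⟩): by the Gärtner–Ellis upper
bound / exponential Chebyshev,
"Λ̄_t(εμ) ≤ ε⟨μ, Euler_t⟩ + o(ε) for every μ" (EulerPressureGerm, the exponential-rate hydrodynamic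
limit) already gives
HydrodynamicLimit, and that germ splits into SLOPE and CURVATURE: MeanEulerLimit (the slope Λ_N'(0)
= mean of the time-t fields
tends to the Euler values — identification, local equilibrium in expectation; a NECESSARY condition
for the conjunct) and
TiltSubGaussian (an N-uniform quadratic bound on the scaled CGF in a real window |b| ≤ r around its
slope — concentration in
exponential currency). Engine (card E1, E4): near every constant state both halves are Taylor data
of ONE function Ψ_N(λ,μ;t) of two
tilts of the INVARIANT Gibbs law, which is exactly reversal-symmetric at finite N (ReversalSymmetry,
Ψ_N(λ,μ;t) = Ψ_N(R̂μ,R̂λ;t)) and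
conjecturally analytic on an N-uniform polydisc (EquilibriumAnalyticity) with BMFT Taylor
coefficients (EquilibriumResponse).
Lean: `MeanEulerLimit ∧ TiltSubGaussian`

## Assembly
Pure logic (proved in the planner's Sketch.lean: `fun hM hS hG hL => hL (hG hM hS)`): the two ranked
cruxes give the germ by the
support GermOfSubGaussianMean and the germ gives the conjunct by the support GermToLimit; σ₀
bookkeeping lives inside the supports.
EquilibriumAnalyticity, EquilibriumResponse and ReversalSymmetry are the engine for the
near-equilibrium children of the two cruxes
(Two-layer plan), deliberately not hypotheses of the assembly.

Rationale: WHY THIS LINE. The Gärtner–Ellis upper bound needs only the one-sided germ of the limiting scaled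
cumulant generating function, so the whole
conjunct (with an exponential rate) is the statement that the μ-germ of the two-time pressure is the
graph of the Euler flow — the
rigorous shadow of ballistic macroscopic fluctuation theory (DoyonEtAl2023, DoyonMyers2019:
Euler-scale LD = initial LD pushed
through Euler), and the germ factors into a mean statement and a uniform quadratic window with
sorry-free glue. The engine is moved
to the one measure we control, the invariant Gibbs law: there the two-time pressure obeys exact
finite-N identities (stationarity,
REVERSAL SYMMETRY from flow_flipVel_ae + Liouville + energy conservation, Cauchy–Schwarz semigroup
inequality), its Taylor
coefficients are N-scaled space-time cumulants of a stationary reversible measure-preserving flow,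
and N-uniform analyticity
(a Lee–Yang / canonical-cluster-expansion statement, LeeYang1952, PulvirentiTsagkarogiannis2012, in
the spirit of the dynamical
exponential-moment expansions BGSSAnnals2023, BodineauEtAl2024) upgrades mean identification to
exponential concentration by a
Cauchy estimate. Imported areas: large deviations / convex duality (KipnisLandim1999 Ch. 10,
Varadhan1993EntropyMethods), analyticity
of partition functions, ballistic MFT (physics, with the explicit dictionary tilt ↔ local Gibbs
profile), Onsager–Casimir
reciprocity at Euler scale (TothValko2003, Spohn1991 §7.1). Unlike the routes on the board it uses
no relative entropy w.r.t. a
time-dependent local Gibbs state (RelEntropyErgodic, VanishingNoise, ChaoticMixing), no expansion of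
correlation functions
(DenseKineticExpansion), no measure-valued solutions (DissipativeWeakStrong) and no pathwise
influence (OneParticleInfluence): the
only currency is the scaled CGF of the conserved fields under the initial law, and reversal enters
at law level only.

RANKED CRUXES. #0 EulerPressureGerm (target) — (the germ of the upper two-time pressure is the Euler
graph = exponential-rate hydrodynamic limit) for all continuous positive profiles ∃ σ₀ ∀ σ ∈ (0,σ₀)
∀ classical hard-sphere-Euler solutions (ρ,u,θ) on [0,T) ∀ flow families, if the local Gibbs fields
satisfy the LLN at t = 0 then ∀ t < T ∀ continuous χ ∀ δ > 0 ∃ ε > 0, eventually in N: E_LG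
exp((N+1) ε (F_t^χ − Euler value)) ≤ exp((N+1) ε δ) for the density field, each momentum component
and the energy field (lower tails via χ ↦ −χ; all three fields are linear in χ). (why it might fail:
the conjunct with an exponential rate: false if Euler-scale fluctuations of deterministic hard
spheres are not exponentially suppressed (hidden slow field, as free streaming is for the ideal
gas), or wherever the conjunct fails (dense excursions, route ImplosionLoophole).) [Spohn1991,
KipnisLandim1999, DoyonEtAl2023, OllaVaradhanYau1993]
#2 MeanEulerLimit (crux) — (slope of the two-time pressure = identification) in the conjunct's frame
— ∀ profiles ∃ σ₀ ∀ σ ∈ (0,σ₀) ∀ classical solutions on [0,T) ∀ flows, LLN at t = 0 ⇒ ∀ t < T ∀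
continuous χ — the EXPECTATIONS under the initial local Gibbs law of the time-t empirical density /
momentum / energy fields tested against χ converge to ∫χρ_t, ∫χρ_t u_t, ∫χE_t. Necessary for the
conjunct (uniform integrability is free from energy conservation and Gaussian velocity moments); in
substance "local equilibrium in the mean": the expected microscopic momentum and energy currents
close on the Euler fluxes with p = ρθZ(ρσ³). [difficulty: open-problem] (why it might fail: the
identification half: a non-Gibbsian Euler-scale structure of the deterministic flow
(BoltzmannHypothesis barrier) gives non-Euler mean currents; nothing controls mean currents of hard
spheres at fixed σ beyond kinetic times O(N^(-1/3)) (BGSS are Boltzmann–Grad).) [Spohn1991,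
OllaVaradhanYau1993, TothValko2003, BodineauGallagherSaintRaymondSimonella2023, BGSSAnnals2023]
#3 TiltSubGaussian (crux) — (curvature window of the two-time pressure = concentration in
exponential currency) in the same frame, ∀ t < T ∀ continuous χ ∃ r > 0 ∃ K ∀ N ∀ b ∈ [−r, r]: E_LG
exp((N+1) b (F_t^χ − E_LG F_t^χ)) ≤ exp((N+1) K b²) for the density field, each momentum component
and the energy field — an N-UNIFORM quadratic bound on the scaled CGF of the time-t fields around
its slope (card E4a in real form: implied by N-uniform analyticity via a Cauchy estimate; implies
Var F_t^χ = O(1/N) and exponential concentration at the mean). [difficulty: open-problem] (why it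
might fail: needs CLT-size O(N^(-1/2)) fluctuations of the time-t fields with N-uniform exponential
moments; anomalous Euler-scale fluctuations at fixed σ (long-time tails, pre-shock steepening, rare
dense clusters) or energy-field tails beyond |b|·sup|χ| < 1/(2 sup θ₀) would force r_N → 0.)
[Spohn1991, BGSSAnnals2023, BodineauGallagherSaintRaymondSimonellaAHP2023, DoyonMyers2019,
NachtergaeleYau2003]
#4 EquilibriumAnalyticity (crux) — (card E4a, the near-equilibrium engine) ∃ σ₀ ∀ σ ∈ (0,σ₀) ∀
constant state (θ̄ > 0, ū) ∀ continuous tilt triples λ = (λ_ρ, λ_m, λ_e), μ ∀ T > 0 ∀ flow families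
∃ r > 0, C ∀ N ∀ t ∈ [0,T]: the two-time moment generating function M_N(a,b) = E_G exp((N+1)(a
S_λ(z) + b S_μ(Φ_t z))) of the invariant Gibbs law G = localGibbsLaw σ 1 ū θ̄ (S_λ(z) = N⁻¹Σ_j
[λ_ρ(x_j) + λ_m(x_j)·v_j + λ_e(x_j)|v_j|²/2]) equals exp((N+1)Λ(a,b)) with Λ holomorphic on the
complex polydisc |a|,|b| < r, Λ(0,0) = 0, |Λ| ≤ C: the two-time pressure Ψ_N = Λ is analytic and
bounded near (0,0) UNIFORMLY in N and t ≤ T (no zeros of the two-time partition function pinch the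
origin: "no Euler-scale dynamical phase transition near equilibrium"). At b = 0 this is canonical
cluster-expansion analyticity; the Taylor coefficients are the N-scaled joint cumulants of (F₀, F_t)
under the stationary flow. [difficulty: open-problem] (why it might fail: a space-TIME cluster
property of the equilibrium hard-sphere flow at fixed σ over macroscopic times: existing dynamical
cumulant expansions are Boltzmann–Grad and kinetic-time (BGSSAnnals2023, BodineauEtAl2024); a hidden
slow mode means zeros of M_N accumulating at (0,0).) [LeeYang1952, PulvirentiTsagkarogiannis2012,
BGSSAnnals2023, BodineauEtAl2024, DoyonEtAl2023]
#5 EquilibriumResponse (crux) — (card E4b, the corrected cumulant engine: μ-order 1, all orders in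
the initial tilt) for the exponentially tilted Gibbs laws G^(aλ) (one-particle weight
M_(1,ū,θ̄)(v)·exp(a(λ_ρ(x) + λ_m(x)·v + λ_e(x)|v|²/2)), i.e. the local Gibbs laws near the constant
state) and any family (ρ^a, u^a, θ^a), |a| < r₀, of classical hard-sphere-Euler solutions on [0,T)
whose data are the LLN limits of G^(aλ) and whose tested time-t value m(a) = ∫(μ_ρ ρ^a_t + μ_m·ρ^a_t
u^a_t + μ_e E^a_t) is real-analytic at a = 0: for every k, (d/da)^k at a = 0 of E_(G^(aλ))[S_μ(Φ_t
z)] converges to m^(k)(0). The left side is the (N+1)^k-scaled joint cumulant κ(S_λ,…,S_λ; S_μ∘Φ_t)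
of the stationary reversible flow (Φ, G): order 1 = Euler-scale equilibrium time correlations =
linearised Euler (Spohn1991 §7.1 (7.13)–(7.19)); order k = (k−1)-st nonlinear Euler response = the
BMFT value (not zero — the retired card equilibrium-cumulant-bootstrap's error). [deps:
EquilibriumAnalyticity] [difficulty: open-problem] (why it might fail: order 1 (Euler-scale
Green–Kubo = linearised Euler) is open at fixed σ — known only at Boltzmann–Grad via linearised
Boltzmann (BGSS CPAM 2023); at orders ≥ 2 an O(σ³) Enskog-level mismatch between equilibrium
dynamics and nonlinear Euler response refutes it.) [Spohn1991, Doyon2022, DoyonEtAl2023,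
DoyonMyers2019, BodineauGallagherSaintRaymondSimonella2023]
#9 ReversalSymmetry (support) — (card E1 (R), exact at finite N, provable now) for the Gibbs law at
rest G = localGibbsLaw σ 1 0 θ̄ of N+1 spheres, any hard-sphere flow Φ, any t and continuous tilt
triples λ, μ: E_G exp((N+1)(S_λ(z) + S_μ(Φ_t z))) = E_G exp((N+1)(S_(R̂μ)(z) + S_(R̂λ)(Φ_t z))) with
R̂(λ_ρ,λ_m,λ_e) = (λ_ρ,−λ_m,λ_e). Proof: G is Φ_t-invariant (Liouville measure preserved, good set ⊆
domain invariant, configEnergy_eq_holds) and flipVel-invariant (measurePreserving_flipVel_liouville,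
centred Maxwellian); substitute z ↦ flipVel(Φ_t z) and use flow_flipVel_ae (Sweep1ReversedProofs).
Consequences: Onsager–Casimir symmetry of all scaled joint cumulants, and Ψ_N(λ,μ;t) =
Ψ_N(R̂μ,R̂λ;t) wherever the logarithm is taken. [difficulty: provable-now] [CIPDiluteGases1994,
Spohn1991, TothValko2003, BertiniEtAl2015, Onsager1944]
#9 GermOfSubGaussianMean (support) — MeanEulerLimit → TiltSubGaussian → EulerPressureGerm (the glue;
provable now): with m_N = E_LG F_t^χ and m the Euler value, E exp((N+1)ε(F − m)) = exp((N+1)ε(m_N −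
m))·E exp((N+1)ε(F − m_N)) ≤ exp((N+1)(ε|m_N − m| + Kε²)) ≤ exp((N+1)εδ) for ε = min(r, δ/(2K+1))
and all N with |m_N − m| ≤ δ/2; σ₀ = min of the two σ₀'s; momentum componentwise (continuity of the
coordinate projections for the limit of the vector mean). [difficulty: provable-now]
[KipnisLandim1999, Varadhan1993EntropyMethods]
#9 GermToLimit (support) — EulerPressureGerm → HydrodynamicLimit (exponential Chebyshev; provable
now): LG(F_t^χ − m > 2δ) ≤ exp(−(N+1)ε·2δ)·E exp((N+1)ε(F_t^χ − m)) ≤ exp(−(N+1)εδ) → 0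
(mul_meas_ge_le_lintegral); lower tails from −χ (empiricalDensityField/MomentumField/EnergyField and
the targets are linear in χ, −χ continuous); a momentum deviation of norm > δ has a component
deviating by > δ/√3 (EuclideanSpace.norm_eq, Fin 3); then hydrodynamicLimit_iff. [difficulty:
provable-now] [KipnisLandim1999, Spohn1991]

TWO-LAYER PLAN. Foreseen glued splits (k ≤ 3, depth 1), filed only when a crux closes or stalls with
a census:
TiltSubGaussian ⇐ NearEqSubGaussian → SubGaussianZoom → TiltSubGaussian, where NearEqSubGaussian
(profiles = small tilts aλ of a
constant state) follows from EquilibriumAnalyticity by the Cauchy estimate in b at fixed real a, and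
SubGaussianZoom is the
hyperbolic-covariance localisation of card first-failure-blowup (a sub-cube of side ℓ is the same
model with (N+1)ℓ³ρ particles and
reduced diameter (ρℓ⁰)^(1/3)σ-type rescaling at the SAME law; needs a law-level light-cone bound for
Maxwellian tails).
MeanEulerLimit ⇐ NearEqMean → MeanZoom → MeanEulerLimit, NearEqMean from EquilibriumAnalyticity +
EquilibriumResponse by Vitali
(N-uniformly bounded analytic family in a whose Taylor coefficients converge). EquilibriumResponse ⇐
Order1 (Euler-scale Green–Kubo,
Spohn1991 (7.13): (N+1)Cov_G(S_λ, S_μ∘Φ_t) → ⟨μ, e^(tA) λ-fields⟩, shared in substance with cards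
transient-covariance-identity,
hydrodynamic-projection-transplant, stationary-shear-rung) → HigherOrders (BMFT nonlinear response)
→ EquilibriumResponse. The
alternative EXISTENCE engine (card E3: Guerra–Toninelli gluing through semi-transparent faces, lim
Ψ_N along dyadic N from an
o(N^(1/3)) exponential-moment one-wall-event influence bound) and the RIGIDITY filter (card E2c:
BMFT form + ReversalSymmetry ⇒
(R̂S_t)² = id and I∘S_t = I for any exponentially concentrating limit map) are filed as typed
support once the definition
hsTwoTimePressure lands; neither is load-bearing for the assembly.

KILL CRITERIA. MeanEulerLimit refuted (a profile, σ-sequence and t < T with non-Euler limiting mean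
fields) refutes the CONJUNCT itself (uniform
integrability is free): close refuted:MeanEulerLimit, witness to the negatives index.
TiltSubGaussian refuted with MeanEulerLimit
intact (CLT-violating Euler-scale fluctuations) kills the exponential currency only: close
refuted:TiltSubGaussian and hand the mean
half to the L2HydroFields routes (DenseKineticExpansion, OneParticleInfluence). EquilibriumResponse
refuted at order 1 (Euler-scale
equilibrium correlations of hard spheres are not linearised Euler) ⇒ MeanEulerLimit false near
equilibrium ⇒ conjunct false —
decisive; refuted only at some order k ≥ 2 with corrected targets available ⇒ restate (route edit
--restate) with the right
response functional, the frame survives. EquilibriumAnalyticity refuted (zeros of M_N at distance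
r_N → 0 from the origin for some
tilt) ⇒ pivot TiltSubGaussian's engine to variance/mixing bounds or close. DenseExcursion (route
ImplosionLoophole, stmt 3090) proved ⇒
the conjunct-as-typed and every all-profile item here inherit the implosion loophole: re-target
MeanEulerLimit / TiltSubGaussian to
the packing-guarded frame of HydroLimitInBand (stmt 3093). RelEntropyVanishing (0766) or
L2HydroFields (0800) proved elsewhere
moots MeanEulerLimit (it follows); the route is then superseded unless TiltSubGaussian is wanted for
the exponential rate.

NOT DECOMPOSED YET. The zoom / localisation lift (law-level light cone despite unbounded
velocities), the static inputs (canonical cluster expansion: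
local Gibbs laws are probability measures for σ < 1/2, LLN identification of (ρ,u,θ)(0), analyticity
at b = 0 — shared with
LocalGibbsConcentration 0767 / HsEosLowDensity 0768 / LocalGibbsDensityLimit 3097), the Galilean
reduction ū = 0, the admissible
energy-tilt range (inside ∃ r, ∃ ε), the stationarity (S) and Cauchy–Schwarz semigroup (C)
identities (prover lemmas riding with
--supports), BMFT form of the full limit Ψ and its Varadhan converse (card E2b), the rigidity filter
E2c and the gluing existence E3
(see Two-layer plan) — none is an item now; constants r, K, C are existential and not tracked.

CHEAPEST FALSIFIER. (i) The ideal gas (collisionless free flight, the library's freeFlight /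
idealGasState of the BoltzmannHypothesis barrier file): its
two-time pressure is an explicit one-particle formula; check on paper that the TiltSubGaussian bound
HOLDS while the MeanEulerLimit
conclusion FAILS for t > 0 (free streaming ≠ Euler) and ReversalSymmetry holds — this calibrates
that identification, not
concentration, carries the Boltzmann-hypothesis content and that no item is vacuous. (ii) Order
(1,1) of EquilibriumResponse in the
Boltzmann–Grad regime must reproduce BodineauGallagherSaintRaymondSimonella2023 (linearised
Boltzmann ⇒ linearised Euler with
ideal-gas sound speed after the kinetic layer) and, at fixed σ, Spohn1991 (7.19) with the
hard-sphere compressibility — a literature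
check of the targets (the retired card died of wrong targets). (iii) MD at packing 0.05–0.1:
N-scaling of (N+1)·Var(F_t^χ) (must
stay bounded) and of the normalised third joint cumulant vs the second-order Euler response; an
N-growing value kills TiltSubGaussian /
EquilibriumAnalyticity. None run here (plancard mode, no kit job).

NUMBERS. Items at open: 9 (1 target, 4 cruxes ranked 2–5, 3 support, 1 assembly). Fluid range of
hard spheres: packing (π/6)ρσ³ < 0.494
(freezing). Static analyticity: canonical cluster expansion converges for activity-type parameters
below the Penrose–Ruelle radius
(LebowitzPenrose1964; PulvirentiTsagkarogiannis2012 Thm 1). Dynamical cumulant expansions for hard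
spheres: Boltzmann–Grad Nε² = α,
times O(1) kinetic (BGSSAnnals2023 Thm 2–3) and long kinetic times at equilibrium
(BodineauEtAl2024); here Nε³ = σ³ fixed and one
macroscopic time unit = O(N^(1/3)) mean free times. Energy-tilt admissibility: |b|·sup|χ|/2 <
1/(2θ̄) for finiteness of
E_G exp((N+1) b F_e^χ) (energy conservation bounds time-t tilts by time-0 Gaussian moments).
Euler-scale equilibrium structure
function: S(k,t) = exp(tA(k)) S(k,0) with A the linearised Euler symbol (Spohn1991 (7.13)–(7.19)).

DEFINITION REQUESTS. D1 (filed after open, topic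
Summits/AtomisticToContinuum/HydrodynamicLimit/Theorems): `tiltStatistic (λ_ρ λ_e : T3 → ℝ) (λ_m :
T3 → V3)
(z) : ℝ := ∫ (λ_ρ x + ⟪λ_m x, v⟫ + λ_e x |v|²/2) d(empiricalMeasure z)` and `hsTwoTimePressure σ θ̄
ū N Φ λ μ t : ℝ :=
(N+1)⁻¹ log ∫ exp((N+1)(tiltStatistic λ z + tiltStatistic μ (Φ_t z))) dG_N` — makes ReversalSymmetry
/ EquilibriumAnalyticity
short and lets E2c (rigidity) and E3 (gluing existence) be typed. No cite facts requested: every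
dynamical input used by the supports
is PROVED in Literature (flow_flipVel_ae, measurePreserving_flipVel_liouville,
configEnergy_eq_holds, flow_eq_ae_holds).

Novelty: Searches (2026-08-15; local searchd down → remote cascades; galaxyd saturated on 4 `--star all`
queries, 0 rows returned):
`lit frontier AtomisticToContinuum --since 2020` (30 rows; none on two-time LD / CGF of Hamiltonian
hard spheres; nearest JSP 2026
doi:10.1007/s10955-026-03570-w moderate deviations for a binary collision model), `lit bridges
AtomisticToContinuum --cross any` (30;
Derrida 2011 arXiv:1012.1136 MFT review), `lit search --source crossref "ballistic macroscopic
fluctuation theory"` (10: Kundu 2025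
doi:10.1088/1742-5468/adfe57, Kethepalli–Urilyon–Sadhu 2026 doi:10.21468/scipostphys.20.4.105,
Bodineau–Derrida 2025
doi:10.1007/s10955-025-03439-4, …), `--source zbmath "Onsager relations Eulerian hydrodynamic
limit"` (1: TothValko2003),
`--source zbmath "ballistic fluctuation theory Euler hydrodynamics cumulant generating function"`
(1: DoyonMyers2019),
`--source zbmath|openalex "large deviations hydrodynamic limit Hamiltonian dynamics Euler
equations"` (0), `lit galaxy search "ballistic macroscopic fluctuation" --star all` (3 pdf hits:
Hübner–Biagetti–De Nardis–Doyon arXiv:2408.04502 diffusive corrections from long-range correlations,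
Krajnik PRE 110 024118, Berlioz–Bénichou–Grabsch arXiv:2412.14661 — physics,
integrable/single-file), `lit galaxy search "time-reversal symmetry of the two-time" --star all`
(0), plus the card's own
2026-08-15 log (crossref / zbmath / galaxy: BMFT papers, Guerra–Toninelli statics only, "two-time
large deviations Euler scale" 0).
Nea  [refs: 10.1007/s10955-026-03570-w, 10.1088/1742-5468/adfe57, 10.21468/scipostphys.20.4.105, 10.1007/s10955-025-03439-4, 1012.1136, 2408.04502, 2412.14661, doi:10.1007/s10955-026-03570-w, doi:10.1088/1742-5468/adfe57, doi:10.21468/scipostphys.20.4.105, doi:10.1007/s10955-025-03439-4, TothValko2003, DoyonMyers2019, DoyonEtAl2023, BGSSAnnals2023, BodineauEtAl2024, QuastelYau1998]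

Barriers (technique_class: two-time-large-deviations gartner-ellis reversal-symmetry): - technique_class: two-time-large-deviations gartner-ellis reversal-symmetry
- Literature.Barriers.AtomisticToContinuum.BoltzmannHypothesisBarrier: no classification of
stationary states of the infinite dynamics is assumed or needed; the ergodic content is isolated and
NAMED — MeanEulerLimit (mean currents close on Euler fluxes) and EquilibriumAnalyticity (no
Euler-scale slow mode near equilibrium); the barrier's ideal-gas witness passes TiltSubGaussian and
ReversalSymmetry and fails MeanEulerLimit, so the frame is sharp exactly where the barrier bites
(Cheapest falsifier (i)).
- Literature.Barriers.AtomisticToContinuum.VelocityReversalBarrier: reversal is used only at LAW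
level — ReversalSymmetry is an identity between Gibbs expectations (evasions_known (i)); every
convergence statement is in exponential moments / probability under local Gibbs data and before the
first shock (scope caveat (b)); no sure derivation, no reversal-invariant good set, flipVel enters
only through the a.e. identity flow_flipVel_ae (scope caveat (c)).
- Literature.Barriers.AtomisticToContinuum.HighMomentumCutoffBarrier: exponential moments of the
ENERGY field exist only for |b|·sup|χ| < 1/(2 sup θ₀); every exponential statement here has its tilt
amplitude existential and innermost (∃ r, ∃ ε), and exact energy conservation
(configEnergy_eq_holds) bounds time-t energy tilts by time-0 Gaussian moments, so no cutoff along
the evolution is assumed — the bet is that CLT-size windows suffice for the Chebysh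

History (route lifecycle, newest last):
- 2026-08-15T13:47:28Z · CLOSED retired — not-a-thesis: assembly does not conclude the sub-problem Statement (operator:999:1257524)

sub-problem: HydrodynamicLimit · status: closed(retired) · opened planner-plancard-AtomisticToContinuum-Hydrody-043a2e95-0 2026-08-15T11:45:08Z · rev 0 · ledger route-AtomisticToContinuum-TwoTimePressure
GENERATED by the gate from the ledger (D-0016/17). Provers cite these decls: `theorem foo : Summit.AtomisticToContinuum.HydrodynamicLimit.Theses.TwoTimePressure.<Decl> := …` in Summits/AtomisticToContinuum/HydrodynamicLimit/Theorems/<Name>.lean.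
-/

namespace Summit.AtomisticToContinuum.HydrodynamicLimit.Theses.TwoTimePressure

open scoped BigOperators Topology Manifold Classical MeasureTheory ProbabilityTheory Matrix InnerProductSpace ComplexConjugate ContinuousMap
open Filter Set Function TopologicalSpace MeasureTheory

attribute [summit_statement] _root_.HydrodynamicLimit

/-- item stmt-AtomisticToContinuum-6217 · target · rank 0 · closed · moot by None · by planner
why it might fail: the conjunct with an exponential rate: false if Euler-scale fluctuations of deterministic hard spheres are not exponentially suppressed (hidden slow field, as free streaming is for the ideal gas), or wherever the conjunct fails (dense excursions, route ImplosionLoophole).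
sources: Spohn1991, KipnisLandim1999, DoyonEtAl2023, OllaVaradhanYau1993
[target] (the germ of the upper two-time pressure is the Euler graph = exponential-rate hydrodynamic
limit) for all continuous positive profiles ∃ σ₀ ∀ σ ∈ (0,σ₀) ∀ classical hard-sphere-Euler
solutions (ρ,u,θ) on [0,T) ∀ flow families, if the local Gibbs fields satisfy the LLN at t = 0 then
∀ t < T ∀ continuous χ ∀ δ > 0 ∃ ε > 0, eventually in N: E_LG exp((N+1) ε (F_t^χ − Euler value)) ≤
exp((N+1) ε δ) for the density field, each momentum component and the energy field (lower tails via
χ ↦ −χ; all three fields are linear in χ). -/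
@[route_item "route-AtomisticToContinuum-TwoTimePressure"]
def EulerPressureGerm : Prop :=
  ∀ (a₀ θ₀ : Literature.MathematicalPhysics.KineticTheory.T3 → ℝ) (u₀ : Literature.MathematicalPhysics.KineticTheory.T3 → Literature.MathematicalPhysics.KineticTheory.V3), Continuous a₀ → Continuous θ₀ → Continuous u₀ → (∀ x, 0 < a₀ x) → (∀ x, 0 < θ₀ x) → ∃ σ₀ : ℝ, 0 < σ₀ ∧ ∀ σ : ℝ, 0 < σ → σ < σ₀ → ∀ (T : ℝ) (ρ θ : ℝ → Literature.MathematicalPhysics.KineticTheory.T3 → ℝ) (u : ℝ → Literature.MathematicalPhysics.KineticTheory.T3 → Literature.MathematicalPhysics.KineticTheory.V3), Literature.MathematicalPhysics.KineticTheory.IsHardSphereEulerSolution σ T ρ u θ → ∀ Φ : (N : ℕ) → Literature.Analysis.FluidPDE.HardSphereFlow (Literature.Analysis.FluidPDE.Torus.geometry (Fin 3)) (Literature.MathematicalPhysics.KineticTheory.hsDiameter σ N) (N + 1), Literature.MathematicalPhysics.KineticTheory.TendstoHydroFieldsAt (fun N => Literature.MathematicalPhysics.KineticTheory.localGibbsLaw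 σ a₀ u₀ θ₀ N (Φ N)) Φ ρ u θ 0 → ∀ t ∈ Set.Ico 0 T, ∀ χ : Literature.MathematicalPhysics.KineticTheory.T3 → ℝ, Continuous χ → ∀ δ : ℝ, 0 < δ → ∃ ε : ℝ, 0 < ε ∧ ∀ᶠ N : ℕ in Filter.atTop, ∫⁻ z, ENNReal.ofReal (Real.exp (((N : ℝ) + 1) * ε * (Literature.MathematicalPhysics.KineticTheory.empiricalDensityField ((Φ N).flow t z) χ - ∫ x, χ x * ρ t x))) ∂(Literature.MathematicalPhysics.KineticTheory.localGibbsLaw σ a₀ u₀ θ₀ N (Φ N)) ≤ ENNReal.ofReal (Real.exp (((N : ℝ) + 1) * ε * δ)) ∧ (∀ i : Fin 3, ∫⁻ z, ENNReal.ofReal (Real.exp (((N : ℝ) + 1) * ε * (Literature.MathematicalPhysics.KineticTheory.empiricalMomentumField ((Φ N).flow t z) χ i - (∫ x, (χ x * ρ t x) • u t x) i))) ∂(Literature.MathematicalPhysics.KineticTheory.localGibbsLaw σ a₀ u₀ θ₀ N (Φ N)) ≤ ENNReal.ofReal (Real.exp (((N : ℝ) + 1) * ε * δ))) ∧ ∫⁻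 z, ENNReal.ofReal (Real.exp (((N : ℝ) + 1) * ε * (Literature.MathematicalPhysics.KineticTheory.empiricalEnergyField ((Φ N).flow t z) χ - ∫ x, χ x * Literature.MathematicalPhysics.KineticTheory.totalEnergyDensity (ρ t x) (u t x) (θ t x)))) ∂(Literature.MathematicalPhysics.KineticTheory.localGibbsLaw σ a₀ u₀ θ₀ N (Φ N)) ≤ ENNReal.ofReal (Real.exp (((N : ℝ) + 1) * ε * δ))

/-- item stmt-AtomisticToContinuum-6218 · crux · rank 2 · closed · moot by None · by planner
why it might fail: the identification half: a non-Gibbsian Euler-scale structure of the deterministic flow (BoltzmannHypothesis barrier) gives non-Euler mean currents; nothing controls mean currents of hard spheres at fixed σ beyond kinetic times O(N^(-1/3)) (BGSS are Boltzmann–Grad).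
sources: Spohn1991, OllaVaradhanYau1993, TothValko2003, BodineauGallagherSaintRaymondSimonella2023, BGSSAnnals2023
[crux] (slope of the two-time pressure = identification) in the conjunct's frame — ∀ profiles ∃ σ₀ ∀
σ ∈ (0,σ₀) ∀ classical solutions on [0,T) ∀ flows, LLN at t = 0 ⇒ ∀ t < T ∀ continuous χ — the
EXPECTATIONS under the initial local Gibbs law of the time-t empirical density / momentum / energy
fields tested against χ converge to ∫χρ_t, ∫χρ_t u_t, ∫χE_t. Necessary for the conjunct (uniform
integrability is free from energy conservation and Gaussian velocity moments); in substance "local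
equilibrium in the mean": the expected microscopic momentum and energy currents close on the Euler
fluxes with p = ρθZ(ρσ³). [difficulty: open-problem] -/
@[route_item "route-AtomisticToContinuum-TwoTimePressure"]
def MeanEulerLimit : Prop :=
  ∀ (a₀ θ₀ : Literature.MathematicalPhysics.KineticTheory.T3 → ℝ) (u₀ : Literature.MathematicalPhysics.KineticTheory.T3 → Literature.MathematicalPhysics.KineticTheory.V3), Continuous a₀ → Continuous θ₀ → Continuous u₀ → (∀ x, 0 < a₀ x) → (∀ x, 0 < θ₀ x) → ∃ σ₀ : ℝ, 0 < σ₀ ∧ ∀ σ : ℝ, 0 < σ → σ < σ₀ → ∀ (T : ℝ) (ρ θ : ℝ → Literature.MathematicalPhysics.KineticTheory.T3 → ℝ) (u : ℝ → Literature.MathematicalPhysics.KineticTheory.T3 → Literature.MathematicalPhysics.KineticTheory.V3), Literature.MathematicalPhysics.KineticTheory.IsHardSphereEulerSolution σ T ρ u θ → ∀ Φ : (N : ℕ) → Literature.Analysis.FluidPDE.HardSphereFlow (Literature.Analysis.FluidPDE.Torus.geometry (Fin 3)) (Literature.MathematicalPhysics.KineticTheory.hsDiameter σ N) (N + 1), Literature.MathematicalPhysics.KineticTheory.TendstoHydroFieldsAt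 (fun N => Literature.MathematicalPhysics.KineticTheory.localGibbsLaw σ a₀ u₀ θ₀ N (Φ N)) Φ ρ u θ 0 → ∀ t ∈ Set.Ico 0 T, ∀ χ : Literature.MathematicalPhysics.KineticTheory.T3 → ℝ, Continuous χ → Filter.Tendsto (fun N : ℕ => ∫ z, Literature.MathematicalPhysics.KineticTheory.empiricalDensityField ((Φ N).flow t z) χ ∂(Literature.MathematicalPhysics.KineticTheory.localGibbsLaw σ a₀ u₀ θ₀ N (Φ N))) Filter.atTop (nhds (∫ x, χ x * ρ t x)) ∧ Filter.Tendsto (fun N : ℕ => ∫ z, Literature.MathematicalPhysics.KineticTheory.empiricalMomentumField ((Φ N).flow t z) χ ∂(Literature.MathematicalPhysics.KineticTheory.localGibbsLaw σ a₀ u₀ θ₀ N (Φ N))) Filter.atTop (nhds (∫ x, (χ x * ρ t x) • u t x)) ∧ Filter.Tendsto (fun N : ℕ => ∫ z, Literature.MathematicalPhysics.KineticTheory.empiricalEnergyField ((Φ N).flow t z) χ ∂(Literature.MathematicalPhysics.KineticTheory.localGibbsLaw σ a₀ u₀ θ₀ N (Φ N))) Filter.atTop (nhds (∫ x, χ x *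 Literature.MathematicalPhysics.KineticTheory.totalEnergyDensity (ρ t x) (u t x) (θ t x)))

/-- item stmt-AtomisticToContinuum-6219 · crux · rank 3 · closed · moot by None · by planner
why it might fail: needs CLT-size O(N^(-1/2)) fluctuations of the time-t fields with N-uniform exponential moments; anomalous Euler-scale fluctuations at fixed σ (long-time tails, pre-shock steepening, rare dense clusters) or energy-field tails beyond |b|·sup|χ| < 1/(2 sup θ₀) would force r_N → 0.
sources: Spohn1991, BGSSAnnals2023, BodineauGallagherSaintRaymondSimonellaAHP2023, DoyonMyers2019, NachtergaeleYau2003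
[crux] (curvature window of the two-time pressure = concentration in exponential currency) in the
same frame, ∀ t < T ∀ continuous χ ∃ r > 0 ∃ K ∀ N ∀ b ∈ [−r, r]: E_LG exp((N+1) b (F_t^χ − E_LG
F_t^χ)) ≤ exp((N+1) K b²) for the density field, each momentum component and the energy field — an
N-UNIFORM quadratic bound on the scaled CGF of the time-t fields around its slope (card E4a in real
form: implied by N-uniform analyticity via a Cauchy estimate; implies Var F_t^χ = O(1/N) and
exponential concentration at the mean). [difficulty: open-problem] -/
@[route_item "route-AtomisticToContinuum-TwoTimePressure"]
def TiltSubGaussian : Prop :=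
  ∀ (a₀ θ₀ : Literature.MathematicalPhysics.KineticTheory.T3 → ℝ) (u₀ : Literature.MathematicalPhysics.KineticTheory.T3 → Literature.MathematicalPhysics.KineticTheory.V3), Continuous a₀ → Continuous θ₀ → Continuous u₀ → (∀ x, 0 < a₀ x) → (∀ x, 0 < θ₀ x) → ∃ σ₀ : ℝ, 0 < σ₀ ∧ ∀ σ : ℝ, 0 < σ → σ < σ₀ → ∀ (T : ℝ) (ρ θ : ℝ → Literature.MathematicalPhysics.KineticTheory.T3 → ℝ) (u : ℝ → Literature.MathematicalPhysics.KineticTheory.T3 → Literature.MathematicalPhysics.KineticTheory.V3), Literature.MathematicalPhysics.KineticTheory.IsHardSphereEulerSolution σ T ρ u θ → ∀ Φ : (N : ℕ) → Literature.Analysis.FluidPDE.HardSphereFlow (Literature.Analysis.FluidPDE.Torus.geometry (Fin 3)) (Literature.MathematicalPhysics.KineticTheory.hsDiameter σ N) (N + 1), Literature.MathematicalPhysics.KineticTheory.TendstoHydroFieldsAt (fun N => Literature.MathematicalPhysics.KineticTheory.localGibbsLaw σ a₀ u₀ θ₀ N (Φ N)) Φ ρ u θ 0 → ∀ t ∈ Set.Ico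 0 T, ∀ χ : Literature.MathematicalPhysics.KineticTheory.T3 → ℝ, Continuous χ → ∃ r : ℝ, 0 < r ∧ ∃ K : ℝ, ∀ N : ℕ, ∀ b ∈ Set.Icc (-r) r, ∫⁻ z, ENNReal.ofReal (Real.exp (((N : ℝ) + 1) * b * (Literature.MathematicalPhysics.KineticTheory.empiricalDensityField ((Φ N).flow t z) χ - ∫ w, Literature.MathematicalPhysics.KineticTheory.empiricalDensityField ((Φ N).flow t w) χ ∂(Literature.MathematicalPhysics.KineticTheory.localGibbsLaw σ a₀ u₀ θ₀ N (Φ N))))) ∂(Literature.MathematicalPhysics.KineticTheory.localGibbsLaw σ a₀ u₀ θ₀ N (Φ N)) ≤ ENNReal.ofReal (Real.exp (((N : ℝ) + 1) * K * b ^ 2)) ∧ (∀ i : Fin 3, ∫⁻ z, ENNReal.ofReal (Real.exp (((N : ℝ) + 1) * b * (Literature.MathematicalPhysics.KineticTheory.empiricalMomentumField ((Φ N).flow t z) χ i - ∫ w, Literature.MathematicalPhysics.KineticTheory.empiricalMomentumField ((Φ N).flow t w) χ i ∂(Literature.MathematicalPhysics.KineticTheory.localGibbsLaw σ a₀ u₀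 θ₀ N (Φ N))))) ∂(Literature.MathematicalPhysics.KineticTheory.localGibbsLaw σ a₀ u₀ θ₀ N (Φ N)) ≤ ENNReal.ofReal (Real.exp (((N : ℝ) + 1) * K * b ^ 2))) ∧ ∫⁻ z, ENNReal.ofReal (Real.exp (((N : ℝ) + 1) * b * (Literature.MathematicalPhysics.KineticTheory.empiricalEnergyField ((Φ N).flow t z) χ - ∫ w, Literature.MathematicalPhysics.KineticTheory.empiricalEnergyField ((Φ N).flow t w) χ ∂(Literature.MathematicalPhysics.KineticTheory.localGibbsLaw σ a₀ u₀ θ₀ N (Φ N))))) ∂(Literature.MathematicalPhysics.KineticTheory.localGibbsLaw σ a₀ u₀ θ₀ N (Φ N)) ≤ ENNReal.ofReal (Real.exp (((N : ℝ) + 1) * K * b ^ 2))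

/-- item stmt-AtomisticToContinuum-6220 · crux · rank 4 · closed · moot by None · by planner
why it might fail: a space-TIME cluster property of the equilibrium hard-sphere flow at fixed σ over macroscopic times: existing dynamical cumulant expansions are Boltzmann–Grad and kinetic-time (BGSSAnnals2023, BodineauEtAl2024); a hidden slow mode means zeros of M_N accumulating at (0,0).
sources: LeeYang1952, PulvirentiTsagkarogiannis2012, BGSSAnnals2023, BodineauEtAl2024, DoyonEtAl2023
[crux] (card E4a, the near-equilibrium engine) ∃ σ₀ ∀ σ ∈ (0,σ₀) ∀ constant state (θ̄ > 0, ū) ∀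
continuous tilt triples λ = (λ_ρ, λ_m, λ_e), μ ∀ T > 0 ∀ flow families ∃ r > 0, C ∀ N ∀ t ∈ [0,T]:
the two-time moment generating function M_N(a,b) = E_G exp((N+1)(a S_λ(z) + b S_μ(Φ_t z))) of the
invariant Gibbs law G = localGibbsLaw σ 1 ū θ̄ (S_λ(z) = N⁻¹Σ_j [λ_ρ(x_j) + λ_m(x_j)·v_j +
λ_e(x_j)|v_j|²/2]) equals exp((N+1)Λ(a,b)) with Λ holomorphic on the complex polydisc |a|,|b| < r,
Λ(0,0) = 0, |Λ| ≤ C: the two-time pressure Ψ_N = Λ is analytic and bounded near (0,0) UNIFORMLY in N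
and t ≤ T (no zeros of the two-time partition function pinch the origin: "no Euler-scale dynamical
phase transition near equilibrium"). At b = 0 this is canonical cluster-expansion analyticity; the
Taylor coefficients are the N-scaled joint cumulants of (F₀, F_t) under the stationary flow.
[difficulty: open-problem] -/
@[route_item "route-AtomisticToContinuum-TwoTimePressure"]
def EquilibriumAnalyticity : Prop :=
  ∃ σ₀ : ℝ, 0 < σ₀ ∧ ∀ σ : ℝ, 0 < σ → σ < σ₀ → ∀ θbar : ℝ, 0 < θbar → ∀ ubar : Literature.MathematicalPhysics.KineticTheory.V3, ∀ (lr le mr me : Literature.MathematicalPhysics.KineticTheory.T3 → ℝ) (lm mm : Literature.MathematicalPhysics.KineticTheory.T3 → Literature.MathematicalPhysics.KineticTheory.V3), Continuous lr → Continuous le → Continuous mr → Continuous me → Continuous lm → Continuous mm → ∀ T : ℝ, 0 < T → ∀ Φ : (N : ℕ) → Literature.Analysis.FluidPDE.HardSphereFlow (Literature.Analysis.FluidPDE.Torus.geometry (Fin 3)) (Literature.MathematicalPhysics.KineticTheory.hsDiameter σ N) (N + 1), ∃ r : ℝ, 0 < r ∧ ∃ C : ℝ, ∀ N : ℕ, ∀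 t ∈ Set.Icc 0 T, ∃ Λ : ℂ × ℂ → ℂ, DifferentiableOn ℂ Λ (Metric.ball 0 r) ∧ Λ 0 = 0 ∧ ∀ p ∈ Metric.ball (0 : ℂ × ℂ) r, ‖Λ p‖ ≤ C ∧ ∫ z, Complex.exp (((N : ℂ) + 1) * (p.1 * ((∫ y, (lr y.1 + ⟪lm y.1, y.2⟫_ℝ + le y.1 * (‖y.2‖ ^ 2 / 2)) ∂Literature.Analysis.FluidPDE.empiricalMeasure z : ℝ) : ℂ) + p.2 * ((∫ y, (mr y.1 + ⟪mm y.1, y.2⟫_ℝ + me y.1 * (‖y.2‖ ^ 2 / 2)) ∂Literature.Analysis.FluidPDE.empiricalMeasure ((Φ N).flow t z) : ℝ) : ℂ))) ∂(Literature.MathematicalPhysics.KineticTheory.localGibbsLaw σ (fun _ => 1) (fun _ => ubar) (fun _ => θbar) N (Φ N)) = Complex.exp (((N : ℂ) + 1) * Λ p)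

/-- item stmt-AtomisticToContinuum-6221 · crux · rank 5 · closed · moot by None · by planner
why it might fail: order 1 (Euler-scale Green–Kubo = linearised Euler) is open at fixed σ — known only at Boltzmann–Grad via linearised Boltzmann (BGSS CPAM 2023); at orders ≥ 2 an O(σ³) Enskog-level mismatch between equilibrium dynamics and nonlinear Euler response refutes it.
sources: Spohn1991, Doyon2022, DoyonEtAl2023, DoyonMyers2019, BodineauGallagherSaintRaymondSimonella2023
[crux] (card E4b, the corrected cumulant engine: μ-order 1, all orders in the initial tilt) for the
exponentially tilted Gibbs laws G^(aλ) (one-particle weight M_(1,ū,θ̄)(v)·exp(a(λ_ρ(x) + λ_m(x)·v +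
λ_e(x)|v|²/2)), i.e. the local Gibbs laws near the constant state) and any family (ρ^a, u^a, θ^a),
|a| < r₀, of classical hard-sphere-Euler solutions on [0,T) whose data are the LLN limits of G^(aλ)
and whose tested time-t value m(a) = ∫(μ_ρ ρ^a_t + μ_m·ρ^a_t u^a_t + μ_e E^a_t) is real-analytic at
a = 0: for every k, (d/da)^k at a = 0 of E_(G^(aλ))[S_μ(Φ_t z)] converges to m^(k)(0). The left side
is the (N+1)^k-scaled joint cumulant κ(S_λ,…,S_λ; S_μ∘Φ_t) of the stationary reversible flow (Φ, G):
order 1 = Euler-scale equilibrium time correlations = linearised Euler (Spohn1991 §7.1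
(7.13)–(7.19)); order k = (k−1)-st nonlinear Euler response = the BMFT value (not zero — the retired
card equilibrium-cumulant-bootstrap's error). [deps: EquilibriumAnalyticity] [difficulty:
open-problem] -/
@[route_item "route-AtomisticToContinuum-TwoTimePressure"]
def EquilibriumResponse : Prop :=
  ∃ σ₀ : ℝ, 0 < σ₀ ∧ ∀ σ : ℝ, 0 < σ → σ < σ₀ → ∀ θbar : ℝ, 0 < θbar → ∀ ubar : Literature.MathematicalPhysics.KineticTheory.V3, ∀ (lr le mr me : Literature.MathematicalPhysics.KineticTheory.T3 → ℝ) (lm mm : Literature.MathematicalPhysics.KineticTheory.T3 → Literature.MathematicalPhysics.KineticTheory.V3), Continuous lr → Continuous le → Continuous mr → Continuous me → Continuous lm → Continuous mm → ∀ (T r₀ : ℝ), 0 < T → 0 < r₀ → ∀ (ρf θf : ℝ → ℝ → Literature.MathematicalPhysics.KineticTheory.T3 → ℝ) (uf : ℝ → ℝ → Literature.MathematicalPhysics.KineticTheory.T3 → Literature.MathematicalPhysics.KineticTheory.V3), (∀ a ∈ Set.Ioo (-r₀) r₀, Literature.MathematicalPhysics.KineticTheory.IsHardSphereEulerSolution σ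 T (ρf a) (uf a) (θf a)) → ∀ Φ : (N : ℕ) → Literature.Analysis.FluidPDE.HardSphereFlow (Literature.Analysis.FluidPDE.Torus.geometry (Fin 3)) (Literature.MathematicalPhysics.KineticTheory.hsDiameter σ N) (N + 1), (∀ a ∈ Set.Ioo (-r₀) r₀, Literature.MathematicalPhysics.KineticTheory.TendstoHydroFieldsAt (fun N => Literature.Analysis.FluidPDE.particleLaw (Φ N) (Literature.Analysis.FluidPDE.canonicalDensity (Literature.Analysis.FluidPDE.Torus.geometry (Fin 3)) (Literature.MathematicalPhysics.KineticTheory.hsDiameter σ N) (N + 1) (fun y : Literature.MathematicalPhysics.KineticTheory.T3 × Literature.MathematicalPhysics.KineticTheory.V3 => Literature.MathematicalPhysics.KineticTheory.localGibbsProfile (fun _ => 1) (fun _ => ubar) (fun _ => θbar) y * Real.exp (a * (lr y.1 + ⟪lm y.1, y.2⟫_ℝ + le y.1 * (‖y.2‖ ^ 2 / 2)))))) Φ (ρf a) (uf a) (θf a) 0) → ∀ t ∈ Set.Ico 0 T, AnalyticAt ℝ (fun a : ℝ => ∫ x, (mr x * ρf a t x + ⟪mm x, (ρf a t x) • uf a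 t x⟫_ℝ + me x * Literature.MathematicalPhysics.KineticTheory.totalEnergyDensity (ρf a t x) (uf a t x) (θf a t x))) 0 → ∀ k : ℕ, Filter.Tendsto (fun N : ℕ => iteratedDeriv k (fun a : ℝ => ∫ z, (∫ y, (mr y.1 + ⟪mm y.1, y.2⟫_ℝ + me y.1 * (‖y.2‖ ^ 2 / 2)) ∂Literature.Analysis.FluidPDE.empiricalMeasure ((Φ N).flow t z)) ∂(Literature.Analysis.FluidPDE.particleLaw (Φ N) (Literature.Analysis.FluidPDE.canonicalDensity (Literature.Analysis.FluidPDE.Torus.geometry (Fin 3)) (Literature.MathematicalPhysics.KineticTheory.hsDiameter σ N) (N + 1) (fun y : Literature.MathematicalPhysics.KineticTheory.T3 × Literature.MathematicalPhysics.KineticTheory.V3 => Literature.MathematicalPhysics.KineticTheory.localGibbsProfile (fun _ => 1) (fun _ => ubar) (fun _ => θbar) y * Real.exp (a * (lr y.1 + ⟪lm y.1, y.2⟫_ℝ + le y.1 * (‖y.2‖ ^ 2 / 2))))))) 0) Filter.atTop (nhds (iteratedDeriv k (fun a : ℝ => ∫ x, (mr x * ρf a t x + ⟪mm x, (ρf a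 t x) • uf a t x⟫_ℝ + me x * Literature.MathematicalPhysics.KineticTheory.totalEnergyDensity (ρf a t x) (uf a t x) (θf a t x))) 0))

/-- item stmt-AtomisticToContinuum-6222 · support · rank 9 · closed · moot by None · by planner
sources: CIPDiluteGases1994, Spohn1991, TothValko2003, BertiniEtAl2015, Onsager1944
[support] (card E1 (R), exact at finite N, provable now) for the Gibbs law at rest G = localGibbsLaw
σ 1 0 θ̄ of N+1 spheres, any hard-sphere flow Φ, any t and continuous tilt triples λ, μ: E_G
exp((N+1)(S_λ(z) + S_μ(Φ_t z))) = E_G exp((N+1)(S_(R̂μ)(z) + S_(R̂λ)(Φ_t z))) with R̂(λ_ρ,λ_m,λ_e) =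
(λ_ρ,−λ_m,λ_e). Proof: G is Φ_t-invariant (Liouville measure preserved, good set ⊆ domain invariant,
configEnergy_eq_holds) and flipVel-invariant (measurePreserving_flipVel_liouville, centred
Maxwellian); substitute z ↦ flipVel(Φ_t z) and use flow_flipVel_ae (Sweep1ReversedProofs).
Consequences: Onsager–Casimir symmetry of all scaled joint cumulants, and Ψ_N(λ,μ;t) =
Ψ_N(R̂μ,R̂λ;t) wherever the logarithm is taken. [difficulty: provable-now] -/
@[route_item "route-AtomisticToContinuum-TwoTimePressure"]
def ReversalSymmetry : Prop :=
  ∀ σ θbar : ℝ, 0 < θbar → ∀ (N : ℕ) (Φ : Literature.Analysis.FluidPDE.HardSphereFlow (Literature.Analysis.FluidPDE.Torus.geometry (Fin 3)) (Literature.MathematicalPhysics.KineticTheory.hsDiameter σ N) (N + 1)) (t : ℝ) (lr le mr me : Literature.MathematicalPhysics.KineticTheory.T3 → ℝ) (lm mm : Literature.MathematicalPhysics.KineticTheory.T3 → Literature.MathematicalPhysics.KineticTheory.V3), Continuous lr → Continuous le → Continuous mr → Continuous me → Continuous lm → Continuous mm → ∫⁻ z, ENNReal.ofReal (Real.exp (((N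 : ℝ) + 1) * (∫ y, (lr y.1 + ⟪lm y.1, y.2⟫_ℝ + le y.1 * (‖y.2‖ ^ 2 / 2)) ∂Literature.Analysis.FluidPDE.empiricalMeasure z + ∫ y, (mr y.1 + ⟪mm y.1, y.2⟫_ℝ + me y.1 * (‖y.2‖ ^ 2 / 2)) ∂Literature.Analysis.FluidPDE.empiricalMeasure (Φ.flow t z)))) ∂(Literature.MathematicalPhysics.KineticTheory.localGibbsLaw σ (fun _ => 1) (fun _ => 0) (fun _ => θbar) N Φ) = ∫⁻ z, ENNReal.ofReal (Real.exp (((N : ℝ) + 1) * (∫ y, (mr y.1 + ⟪-(mm y.1), y.2⟫_ℝ + me y.1 * (‖y.2‖ ^ 2 / 2)) ∂Literature.Analysis.FluidPDE.empiricalMeasure z + ∫ y, (lr y.1 + ⟪-(lm y.1), y.2⟫_ℝ + le y.1 * (‖y.2‖ ^ 2 / 2)) ∂Literature.Analysis.FluidPDE.empiricalMeasure (Φ.flow t z)))) ∂(Literature.MathematicalPhysics.KineticTheory.localGibbsLaw σ (fun _ => 1) (fun _ => 0) (fun _ => θbar) N Φ)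

/-- item stmt-AtomisticToContinuum-6223 · support · rank 9 · closed · moot by None · by planner
sources: KipnisLandim1999, Varadhan1993EntropyMethods
[support] MeanEulerLimit → TiltSubGaussian → EulerPressureGerm (the glue; provable now): with m_N =
E_LG F_t^χ and m the Euler value, E exp((N+1)ε(F − m)) = exp((N+1)ε(m_N − m))·E exp((N+1)ε(F − m_N))
≤ exp((N+1)(ε|m_N − m| + Kε²)) ≤ exp((N+1)εδ) for ε = min(r, δ/(2K+1)) and all N with |m_N − m| ≤
δ/2; σ₀ = min of the two σ₀'s; momentum componentwise (continuity of the coordinate projections for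
the limit of the vector mean). [difficulty: provable-now] -/
@[route_item "route-AtomisticToContinuum-TwoTimePressure"]
def GermOfSubGaussianMean : Prop :=
  MeanEulerLimit → TiltSubGaussian → EulerPressureGerm

/-- item stmt-AtomisticToContinuum-6224 · support · rank 9 · closed · moot by None · by planner
sources: KipnisLandim1999, Spohn1991
[support] EulerPressureGerm → HydrodynamicLimit (exponential Chebyshev; provable now): LG(F_t^χ − m
> 2δ) ≤ exp(−(N+1)ε·2δ)·E exp((N+1)ε(F_t^χ − m)) ≤ exp(−(N+1)εδ) → 0 (mul_meas_ge_le_lintegral);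
lower tails from −χ (empiricalDensityField/MomentumField/EnergyField and the targets are linear in
χ, −χ continuous); a momentum deviation of norm > δ has a component deviating by > δ/√3
(EuclideanSpace.norm_eq, Fin 3); then hydrodynamicLimit_iff. [difficulty: provable-now] -/
@[route_item "route-AtomisticToContinuum-TwoTimePressure"]
def GermToLimit : Prop :=
  EulerPressureGerm → Literature.MathematicalPhysics.KineticTheory.HydrodynamicLimit

/-- item stmt-AtomisticToContinuum-6225 · assembly · rank 1 · closed · moot by None · by planner
sources: Spohn1991, KipnisLandim1999
[assembly] MeanEulerLimit → TiltSubGaussian → GermOfSubGaussianMean → GermToLimit →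
HydrodynamicLimit. -/
@[route_item "route-AtomisticToContinuum-TwoTimePressure"]
def Assembly : Prop :=
  MeanEulerLimit → TiltSubGaussian → GermOfSubGaussianMean → GermToLimit → Literature.MathematicalPhysics.KineticTheory.HydrodynamicLimit

end Summit.AtomisticToContinuum.HydrodynamicLimit.Theses.TwoTimePressure
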